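import Mathlib
import Summits.NavierStokesRegularity.NavierStokesRegularity.Theorems.SubOnsagerCeilingKPSecondaryAssembly
import HarnessLib

/-!
# Secondary sources of a KP network proper, III: GRADED secondary structures (multi-step slaving)
(helper file for crux stmt-NavierStokesRegularity-27057 `SubOnsagerCeiling.ForwardTailCeilingKP`,
`--supports … --as helper`; LEAD SE seat ns-senv-p1 as KEY-NS #146 (1) / #147 (3) hands for LEAD SOC;
extends p651249 `…KPSecondaryAssembly`)

The one-step assembly (p651249) asks every non-primary source to see only PRIMARY modes (feeders,
in-shell partners, its target's partners). Here the structure is GRADED by a level function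
`lev : Fin 4 → ℕ` (level `0` = primary): a source of level `ℓ ≥ 1` may be fed by, share its shell form
with, and have its target drained by any ADMISSIBLE mode of strictly lower level — admissible meaning
primary or itself a forward source (dead-end pockets are never admissible partners: their amplitude is
not controlled). By induction on the level, every forward source of level `ℓ` obeys
`|X_{a,k}| ≤ (20R)^ℓ · M (1+ε₀)^{-θk}` (`kpProper_sources_envelope_graded`), uniformly in `ν`, and the
class-level conditional follows as before (`fwdCeilingKP_of_gradedEnvelope`): structural clauses for
`(α, lev)` with `lev ≤ L` and a ν-uniform `θ`-barrier (`1/2 < θ ≤ 1`) of the level-`0` modes along every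
honest viscous solution imply the body of `FwdCeilingKPAt R ε₀ α` verbatim, with `S = S⁺(α)`, the same
`θ`, and `C = 4·(20R)^{2L}·max(D,1)/(1 − (1+ε₀)^{-2θ})`. Example architectures now covered: chain →
in-shell side source `s₁` → cross-shell source `s₂` (fed by `s₁²`) → pocket; relay and detour side
structures of the W5 instrument rows, as long as no secondary drains back into a non-primary,
non-lower-level mode (re-entry stays excluded).

HONEST FRAMING: statements about Tao-type MODEL lattice tables (rung TL-M2Break, route SubOnsagerCeiling);
a conditional reduction, not a proof of the crux; nothing here bears on Navier–Stokes regularity.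
-/

noncomputable section

-- the sub-problem namespace `NavierStokesRegularity.NavierStokesRegularity` is the tree's layout (D-0017)
set_option linter.dupNamespace false

namespace Summit.NavierStokesRegularity.NavierStokesRegularity.Theorems

open Set Finset Filter Topology
open Literature.Analysis.FluidPDE.TaoCascade

/-! ## §1 Per-solution graded assembly -/

/-- **GRADED ASSEMBLY (per solution).** KP network proper `α ∈ E₂(R)`, `0 < ε₀ ≤ 1`, an honest
`ν`-viscous solution on `[0,s]` (zero datum on shells `≥ 1`, non-negative there, all modes bounded by `W`),
a level function `lev : Fin 4 → ℕ` and an envelope `|X_{i,k}(t)| ≤ M(1+ε₀)^{-θk}` of the LEVEL-0 modes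
(`0 ≤ θ ≤ 1`, `M > 0`) plus `|X_{j,0}(t)| ≤ M` for every `j`. STRUCTURE: every forward source `a` of
level `≥ 1` has (F) feeders, (Q) in-shell partners and (T) for SOME target `e` the feed targets and pump
partners of `e` all ADMISSIBLE — of strictly lower level and either of level `0` or forward sources
themselves. THEN every mode `a` that is of level `0` or a forward source obeys
`|X_{a,k}(t)| ≤ (20R)^{lev a} · M (1+ε₀)^{-θk}` for all `k ≥ 0`, `t ∈ [0,s]`, for every `ν ≥ 0`.
MODEL lattice statement. [this file] -/
theorem kpProper_sources_envelope_graded {ε₀ ν s R M θ W : ℝ}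
    {α : Fin 4 → Fin 4 → Fin 4 → ℤ × ℤ × ℤ → ℝ} {X : Fin 4 → ℤ → ℝ → ℝ}
    (hα : InTableClass R α)
    (hO : ∀ (Y : Fin 4 → ℤ → ℝ → ℝ) (τ : ℝ), (∀ (j : Fin 4) (k : ℤ), 1 ≤ k → 0 ≤ Y j k τ) →
      ∀ δ : ℝ, 0 < δ → ∀ (i : Fin 4) (n : ℤ), 1 ≤ n → Y i n τ = 0 → 0 ≤ quadTerm δ α Y i n τ)
    (hD : ∀ a b i : Fin 4, a ≠ b → α a b i (0, 0, 1) = 0)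
    (hR : 1 ≤ R) (hε : 0 < ε₀) (hε1 : ε₀ ≤ 1) (hν : 0 ≤ ν) (hθ0 : 0 ≤ θ) (hθ1 : θ ≤ 1) (hM : 0 < M)
    (hder : ∀ (i : Fin 4) (k : ℤ), ∀ t ∈ Icc (0 : ℝ) s, HasDerivWithinAt (X i k)
      (quadTerm ε₀ α X i k t - ν * (1 + ε₀) ^ ((2 : ℝ) * k) * X i k t) (Icc (0 : ℝ) s) t)
    (hdat : ∀ (i : Fin 4) (k : ℤ), 1 ≤ k → X i k 0 = 0)
    (hnn : ∀ t ∈ Icc (0 : ℝ) s, ∀ (i : Fin 4) (k : ℤ), 1 ≤ k → 0 ≤ X i k t)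
    (hWbd : ∀ t ∈ Icc (0 : ℝ) s, ∀ (j : Fin 4) (k : ℤ), |X j k t| ≤ W)
    (lev : Fin 4 → ℕ)
    (hP : ∀ t ∈ Icc (0 : ℝ) s, ∀ i, lev i = 0 → ∀ k : ℕ, |X i (k : ℤ) t| ≤ M * (1 + ε₀) ^ (-(θ * (k : ℝ))))
    (h0 : ∀ t ∈ Icc (0 : ℝ) s, ∀ j, |X j 0 t| ≤ M)
    (hstruct : ∀ a, lev a ≠ 0 → (∃ e, α a a e (0, 0, 1) ≠ 0) →
      (∀ j, α j j a (0, 0, 1) ≠ 0 → lev j < lev a ∧ (lev j = 0 ∨ ∃ e', α j j e' (0, 0, 1) ≠ 0)) ∧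
      (∀ i₁ i₂, i₁ ≠ a → i₂ ≠ a → α i₁ i₂ a (0, 0, 0) ≠ 0 →
        (lev i₁ < lev a ∧ (lev i₁ = 0 ∨ ∃ e', α i₁ i₁ e' (0, 0, 1) ≠ 0)) ∧
        (lev i₂ < lev a ∧ (lev i₂ = 0 ∨ ∃ e', α i₂ i₂ e' (0, 0, 1) ≠ 0))) ∧
      (∃ e, α a a e (0, 0, 1) ≠ 0 ∧
        (∀ j, α e e j (0, 0, 1) ≠ 0 → lev j < lev a ∧ (lev j = 0 ∨ ∃ e', α j j e' (0, 0, 1) ≠ 0)) ∧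
        (∀ j, j ≠ e → α e e j (0, 0, 0) ≠ 0 →
          lev j < lev a ∧ (lev j = 0 ∨ ∃ e', α j j e' (0, 0, 1) ≠ 0)))) :
    ∀ t ∈ Icc (0 : ℝ) s, ∀ a, (lev a = 0 ∨ ∃ e, α a a e (0, 0, 1) ≠ 0) →
      ∀ k : ℕ, |X a (k : ℤ) t| ≤ (20 * R) ^ (lev a) * M * (1 + ε₀) ^ (-(θ * (k : ℝ))) := by
  have hb : (0 : ℝ) < 1 + ε₀ := by linarith
  have hb1 : (1 : ℝ) ≤ 1 + ε₀ := by linarith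
  have hR20 : (1 : ℝ) ≤ 20 * R := by linarith
  -- strong induction on the level
  suffices H : ∀ ℓ : ℕ, ∀ t ∈ Icc (0 : ℝ) s, ∀ a, lev a = ℓ → (lev a = 0 ∨ ∃ e, α a a e (0, 0, 1) ≠ 0) →
      ∀ k : ℕ, |X a (k : ℤ) t| ≤ (20 * R) ^ ℓ * M * (1 + ε₀) ^ (-(θ * (k : ℝ))) by
    intro t ht a ha k; exact H (lev a) t ht a rfl ha k
  intro ℓ
  induction ℓ using Nat.strong_induction_on with
  | _ ℓ ih =>
    intro t ht a haℓ ha k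
    have hpowpos : 0 < (1 + ε₀) ^ (-(θ * (k : ℝ))) := Real.rpow_pos_of_pos hb _
    have hRpow : (1 : ℝ) ≤ (20 * R) ^ ℓ := one_le_pow₀ hR20
    rcases Nat.eq_zero_or_pos ℓ with hℓ0 | hℓpos
    · -- level 0: the hypothesis
      subst hℓ0
      have h := hP t ht a haℓ k
      simpa using h
    -- level ℓ ≥ 1: `a` is a forward source
    have hlevne : lev a ≠ 0 := by omega
    have hsrc : ∃ e, α a a e (0, 0, 1) ≠ 0 := by
      rcases ha with h | h
      · exact absurd h hlevne
      · exact h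
    obtain ⟨hF, hQ, e, hwe, hTf, hTp⟩ := hstruct a hlevne hsrc
    -- envelope constant of the admissible partners: `(20R)^(ℓ-1) · M`
    set Mℓ : ℝ := (20 * R) ^ (ℓ - 1) * M with hMℓ
    have hMℓpos : 0 < Mℓ := by positivity
    have hMle : M ≤ Mℓ := by
      have : (1 : ℝ) ≤ (20 * R) ^ (ℓ - 1) := one_le_pow₀ hR20
      simp only [hMℓ]; nlinarith
    -- admissible partners are enveloped by `Mℓ` at every shell (induction hypothesis)
    have hadm : ∀ u ∈ Icc (0 : ℝ) s, ∀ j, (lev j < lev a ∧ (lev j = 0 ∨ ∃ e', α j j e' (0, 0, 1) ≠ 0)) →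
        ∀ m : ℕ, |X j (m : ℤ) u| ≤ Mℓ * (1 + ε₀) ^ (-(θ * (m : ℝ))) := by
      intro u hu j hj m
      have hlt : lev j < ℓ := by rw [← haℓ]; exact hj.1
      have h := ih (lev j) hlt u hu j rfl hj.2 m
      have hmono : (20 * R) ^ (lev j) ≤ (20 * R) ^ (ℓ - 1) := pow_le_pow_right₀ hR20 (by omega)
      have hc : 0 ≤ M * (1 + ε₀) ^ (-(θ * (m : ℝ))) := by positivity
      calc |X j (m : ℤ) u| ≤ (20 * R) ^ (lev j) * M * (1 + ε₀) ^ (-(θ * (m : ℝ))) := h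
        _ = (20 * R) ^ (lev j) * (M * (1 + ε₀) ^ (-(θ * (m : ℝ)))) := by ring
        _ ≤ (20 * R) ^ (ℓ - 1) * (M * (1 + ε₀) ^ (-(θ * (m : ℝ)))) :=
            mul_le_mul_of_nonneg_right hmono hc
        _ = Mℓ * (1 + ε₀) ^ (-(θ * (m : ℝ))) := by simp only [hMℓ]; ring
    have hgoal_eq : (20 * R) ^ ℓ * M = 20 * R * Mℓ := by
      have : ℓ = (ℓ - 1) + 1 := by omega
      simp only [hMℓ]
      conv_lhs => rw [this, pow_succ]
      ring
    rcases Nat.eq_zero_or_pos k with hk0 | hkpos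
    · -- shell 0: `|X_{a,0}| ≤ M ≤ (20R)^ℓ M`
      subst hk0
      have h := h0 t ht a
      have h20 : Mℓ ≤ 20 * R * Mℓ := by nlinarith
      have : M ≤ (20 * R) ^ ℓ * M * (1 + ε₀) ^ (-(θ * ((0 : ℕ) : ℝ))) := by
        simp only [Nat.cast_zero, mul_zero, neg_zero, Real.rpow_zero, mul_one]
        rw [hgoal_eq]; linarith
      simpa using h.trans this
    -- shells k ≥ 1: the secondary barrier at scale `A = Mℓ (1+ε₀)^{-θk}`
    set A : ℝ := Mℓ * (1 + ε₀) ^ (-(θ * (k : ℝ))) with hA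
    have hApos : 0 < A := by positivity
    have hk1 : (1 : ℤ) ≤ (k : ℤ) := by exact_mod_cast hkpos
    have hup : ∀ m : ℕ, k ≤ m → Mℓ * (1 + ε₀) ^ (-(θ * (m : ℝ))) ≤ A := by
      intro m hm
      have : (1 + ε₀) ^ (-(θ * (m : ℝ))) ≤ (1 + ε₀) ^ (-(θ * (k : ℝ))) := by
        apply Real.rpow_le_rpow_of_exponent_le hb1
        have : (k : ℝ) ≤ m := by exact_mod_cast hm
        nlinarith
      exact mul_le_mul_of_nonneg_left this hMℓpos.le
    have hdown : Mℓ * (1 + ε₀) ^ (-(θ * (((k - 1 : ℕ)) : ℝ))) ≤ 2 * A := by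
      have hcast : (((k - 1 : ℕ)) : ℝ) = (k : ℝ) - 1 := by
        rw [Nat.cast_sub (by omega)]; simp
      rw [hcast]
      have hsplit : (1 + ε₀) ^ (-(θ * ((k : ℝ) - 1))) = (1 + ε₀) ^ (-(θ * (k : ℝ))) * (1 + ε₀) ^ θ := by
        rw [← Real.rpow_add hb]; congr 1; ring
      have hθle : (1 + ε₀) ^ θ ≤ 2 := by
        have h1 : (1 + ε₀) ^ θ ≤ (1 + ε₀) ^ (1 : ℝ) := Real.rpow_le_rpow_of_exponent_le hb1 hθ1
        rw [Real.rpow_one] at h1; linarith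
      rw [hsplit]
      have : Mℓ * ((1 + ε₀) ^ (-(θ * (k : ℝ))) * (1 + ε₀) ^ θ) = A * (1 + ε₀) ^ θ := by simp only [hA]; ring
      rw [this]
      nlinarith [Real.rpow_pos_of_pos hb θ]
    have ek1 : ((k : ℤ) - 1) = (((k - 1 : ℕ)) : ℤ) := by omega
    have ek2 : ((k : ℤ) + 1) = (((k + 1 : ℕ)) : ℤ) := by push_cast; ring
    have ek3 : ((k : ℤ) + 2) = (((k + 2 : ℕ)) : ℤ) := by push_cast; ring
    have hres := kpProper_secondary_barrier (T := s) (W := W) hα hO hD hR hε hε1 hν a e (k : ℤ) hwe hApos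
      (hder a k) (hder e ((k : ℤ) + 1)) hWbd
      (by -- feeders (F)
        intro u hu j hj
        have h := hadm u hu j (hF j hj) (k - 1)
        rw [ek1]
        exact h.trans hdown)
      (fun u hu j => hnn u hu j k hk1)
      (by -- face partners (Q)
        intro u hu i₁ i₂ h1 h2 h12
        obtain ⟨hi1, hi2⟩ := hQ i₁ i₂ h1 h2 h12
        exact ⟨(le_abs_self _).trans ((hadm u hu i₁ hi1 k).trans (hup k le_rfl)),
          (le_abs_self _).trans ((hadm u hu i₂ hi2 k).trans (hup k le_rfl))⟩)
      (fun u hu j => hnn u hu j ((k : ℤ) + 1) (by omega))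
      (by -- pump partners of the target (T)
        intro u hu j hje hpj
        have h := hadm u hu j (hTp j hje hpj) (k + 1)
        rw [ek2]
        exact (le_abs_self _).trans (h.trans (hup (k + 1) (by omega))))
      (fun u hu j => hnn u hu j ((k : ℤ) + 2) (by omega))
      (by -- feed targets of the target (T)
        intro u hu j hj
        have h := hadm u hu j (hTf j hj) (k + 2)
        rw [ek3]
        exact (le_abs_self _).trans (h.trans (hup (k + 2) (by omega))))
      (by rw [hdat a k hk1]; positivity)
      t ht
    have hXnn : 0 ≤ X a k t := hnn t ht a k hk1
    rw [abs_of_nonneg hXnn]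
    have : (20 * R) ^ ℓ * M * (1 + ε₀) ^ (-(θ * (k : ℝ))) = 20 * R * A := by
      rw [hgoal_eq]; simp only [hA]; ring
    linarith

/-! ## §2 The class-level conditional for graded structures -/

/-- **THE CONDITIONAL ASSEMBLY, GRADED (class level).** For a table `α`, a level function `lev ≤ L`
with the graded structural clauses for every forward source of positive level, `R ≥ 1`, `0 < ε₀ ≤ 1`,
`1/2 < θ ≤ 1`, any `D`: IF the level-`0` modes obey the ν-uniform `θ`-shell barrier
`(1+ε₀)^{2θk}·½X_{i,k}(t)² ≤ D·E₀` along every honest `ν`-viscous solution from one-shell data, THEN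
the per-table body of `ForwardTailCeilingKP` holds for `(R, ε₀, α)` — the skeleton's
`FwdCeilingKPAt R ε₀ α` verbatim — with `S = S⁺(α)`, the same `θ`, and
`C = 4(20R)^{2L} max(D,1)/(1 − (1+ε₀)^{-2θ})`. MODEL lattice statement; a conditional reduction, not a
proof of the crux. [this file] -/
theorem fwdCeilingKP_of_gradedEnvelope {R ε₀ θ D : ℝ} {α : Fin 4 → Fin 4 → Fin 4 → ℤ × ℤ × ℤ → ℝ}
    (lev : Fin 4 → ℕ) {L : ℕ} (hL : ∀ a, lev a ≤ L)
    (hR : 1 ≤ R) (hε : 0 < ε₀) (hε1 : ε₀ ≤ 1) (hθ : 1 / 2 < θ) (hθ1 : θ ≤ 1)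
    (hstruct : ∀ a, lev a ≠ 0 → (∃ e, α a a e (0, 0, 1) ≠ 0) →
      (∀ j, α j j a (0, 0, 1) ≠ 0 → lev j < lev a ∧ (lev j = 0 ∨ ∃ e', α j j e' (0, 0, 1) ≠ 0)) ∧
      (∀ i₁ i₂, i₁ ≠ a → i₂ ≠ a → α i₁ i₂ a (0, 0, 0) ≠ 0 →
        (lev i₁ < lev a ∧ (lev i₁ = 0 ∨ ∃ e', α i₁ i₁ e' (0, 0, 1) ≠ 0)) ∧
        (lev i₂ < lev a ∧ (lev i₂ = 0 ∨ ∃ e', α i₂ i₂ e' (0, 0, 1) ≠ 0))) ∧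
      (∃ e, α a a e (0, 0, 1) ≠ 0 ∧
        (∀ j, α e e j (0, 0, 1) ≠ 0 → lev j < lev a ∧ (lev j = 0 ∨ ∃ e', α j j e' (0, 0, 1) ≠ 0)) ∧
        (∀ j, j ≠ e → α e e j (0, 0, 0) ≠ 0 →
          lev j < lev a ∧ (lev j = 0 ∨ ∃ e', α j j e' (0, 0, 1) ≠ 0))))
    (hprim : ∀ ν : ℝ, 0 < ν → ∀ (X₀ : Fin 4 → ℝ) (s : ℝ), 0 < s → ∀ X : Fin 4 → ℤ → ℝ → ℝ,
      (∀ (i : Fin 4) (k : ℤ), X i k 0 = if k = 0 then X₀ i else 0) →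
      (∀ (i : Fin 4) (k : ℤ), k < 0 → ∀ t : ℝ, X i k t = 0) →
      (∃ M : ℝ, ∀ (t : ℝ) (i : Fin 4) (k : ℤ), (1 + (1 + ε₀) ^ ((10 : ℝ) * k)) * |X i k t| ≤ M) →
      (∀ (i : Fin 4) (k : ℤ), Continuous (X i k)) →
      (∀ (i : Fin 4) (k : ℤ), ∀ t ∈ Set.Icc (0 : ℝ) s, HasDerivWithinAt (X i k)
        (quadTerm ε₀ α X i k t - ν * (1 + ε₀) ^ ((2 : ℝ) * k) * X i k t) (Set.Icc (0 : ℝ) s) t) →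
      (∀ t ∈ Set.Icc (0 : ℝ) s, ∀ (i : Fin 4) (k : ℤ), 1 ≤ k → 0 ≤ X i k t) →
      ∀ t ∈ Set.Icc (0 : ℝ) s, ∀ i, lev i = 0 → ∀ k : ℕ,
        (1 + ε₀) ^ (2 * θ * (k : ℝ)) * ((1 / 2 : ℝ) * X i (k : ℤ) t ^ 2) ≤
          D * (∑ j : Fin 4, (1 / 2 : ℝ) * X₀ j ^ 2)) :
    InTableClass R α →
    (∀ (Y : Fin 4 → ℤ → ℝ → ℝ) (τ : ℝ), (∀ (j : Fin 4) (k : ℤ), 1 ≤ k → 0 ≤ Y j k τ) →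
      ∀ δ : ℝ, 0 < δ → ∀ (i : Fin 4) (n : ℤ), 1 ≤ n → Y i n τ = 0 → 0 ≤ quadTerm δ α Y i n τ) →
    (∀ a b i : Fin 4, a ≠ b → α a b i (0, 0, 1) = 0) →
    ∃ S : Finset (Fin 4), (∀ i, i ∉ S → ∀ j l : Fin 4, α i j l (0, 0, 1) = 0) ∧
      ∃ θ' : ℝ, 1 / 2 < θ' ∧ ∃ C : ℝ, 0 ≤ C ∧ ∀ ν : ℝ, 0 < ν → ∀ (X₀ : Fin 4 → ℝ) (s : ℝ), 0 < s →
      ∀ X : Fin 4 → ℤ → ℝ → ℝ,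
      (∀ (i : Fin 4) (k : ℤ), X i k 0 = if k = 0 then X₀ i else 0) →
      (∀ (i : Fin 4) (k : ℤ), k < 0 → ∀ t : ℝ, X i k t = 0) →
      (∃ M : ℝ, ∀ (t : ℝ) (i : Fin 4) (k : ℤ), (1 + (1 + ε₀) ^ ((10 : ℝ) * k)) * |X i k t| ≤ M) →
      (∀ (i : Fin 4) (k : ℤ), Continuous (X i k)) →
      (∀ (i : Fin 4) (k : ℤ), ∀ t ∈ Set.Icc (0 : ℝ) s, HasDerivWithinAt (X i k)
        (quadTerm ε₀ α X i k t - ν * (1 + ε₀) ^ ((2 : ℝ) * k) * X i k t) (Set.Icc (0 : ℝ) s) t) →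
      (∀ t ∈ Set.Icc (0 : ℝ) s, ∀ (i : Fin 4) (k : ℤ), 1 ≤ k → 0 ≤ X i k t) →
      ∀ n N : ℕ, n ≤ N → ∀ t ∈ Set.Icc (0 : ℝ) s,
        ∑ k ∈ Finset.Icc n N, ∑ i ∈ S, (1 / 2 : ℝ) * X i (k : ℤ) t ^ 2 ≤
          C * (∑ i : Fin 4, (1 / 2 : ℝ) * X₀ i ^ 2) * (1 + ε₀) ^ (-(2 * θ' * (n : ℝ))) := by
  classical
  intro hα hO hDg
  obtain ⟨_, hc, _⟩ := hα
  have hb : (0 : ℝ) < 1 + ε₀ := by linarith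
  have hb1lt : (1 : ℝ) < 1 + ε₀ := by linarith
  -- the forward sources
  set S : Finset (Fin 4) := Finset.univ.filter (fun a => ∃ e, α a a e (0, 0, 1) ≠ 0) with hSdef
  have hSmem : ∀ a, a ∈ S ↔ ∃ e, α a a e (0, 0, 1) ≠ 0 := by
    intro a; simp [hSdef]
  -- the constant
  set r : ℝ := (1 + ε₀) ^ (-(2 * θ)) with hr_def
  have hr1 : r < 1 := by
    have : (1 + ε₀) ^ (-(2 * θ)) < (1 + ε₀) ^ (0 : ℝ) :=
      Real.rpow_lt_rpow_of_exponent_lt hb1lt (by linarith)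
    simpa [hr_def] using this
  have h1r : 0 < 1 - r := by linarith
  refine ⟨S, ?_, θ, hθ, 4 * (20 * R) ^ (2 * L) * max D 1 / (1 - r), by positivity, ?_⟩
  · -- non-sources have no forward feed (diagonal entries by definition of `S`, off-diagonal by (hD))
    intro i hi j l
    by_cases hij : i = j
    · subst hij
      by_contra hne
      exact hi ((hSmem i).2 ⟨l, hne⟩)
    · exact hDg i j l hij
  intro ν hν X₀ s hs X hdat hlow hMX hcont hder hnn n N hnN t ht
  set E₀ : ℝ := ∑ j : Fin 4, (1 / 2 : ℝ) * X₀ j ^ 2 with hE₀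
  have hE₀0 : 0 ≤ E₀ := Finset.sum_nonneg fun j _ => by positivity
  obtain ⟨Mw, hMw⟩ := hMX
  -- the crude bound `W = Mw` on every mode
  have hWbd : ∀ u ∈ Icc (0 : ℝ) s, ∀ (j : Fin 4) (k : ℤ), |X j k u| ≤ Mw := by
    intro u _ j k
    have h1 := hMw u j k
    have h2 : (1 : ℝ) ≤ 1 + (1 + ε₀) ^ ((10 : ℝ) * k) := by
      have := Real.rpow_pos_of_pos hb ((10 : ℝ) * k); linarith
    have h3 : |X j k u| ≤ (1 + (1 + ε₀) ^ ((10 : ℝ) * k)) * |X j k u| :=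
      le_mul_of_one_le_left (abs_nonneg _) h2
    exact h3.trans h1
  -- the energy bound at shell 0: `½X_{j,0}(u)² ≤ E₀`
  have hshell0 : ∀ u ∈ Icc (0 : ℝ) s, ∀ j, (1 / 2 : ℝ) * X j 0 u ^ 2 ≤ E₀ := by
    intro u hu j
    have hEn := orthantBreak_energy_le hε hν hc hdat hlow hMw hder hu
    have hsum : Summable fun m : ℕ => ∑ i : Fin 4, (1 / 2 : ℝ) * X i (m : ℤ) u ^ 2 :=
      (orthantBreak_summable hε hMw 0 u).congr fun m => by simp
    have h0le : (∑ i : Fin 4, (1 / 2 : ℝ) * X i ((0 : ℕ) : ℤ) u ^ 2) ≤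
        ∑' m : ℕ, ∑ i : Fin 4, (1 / 2 : ℝ) * X i (m : ℤ) u ^ 2 :=
      hsum.le_tsum 0 (fun m _ => Finset.sum_nonneg fun i _ => by positivity)
    have hj : (1 / 2 : ℝ) * X j 0 u ^ 2 ≤ ∑ i : Fin 4, (1 / 2 : ℝ) * X i ((0 : ℕ) : ℤ) u ^ 2 := by
      have := Finset.single_le_sum (f := fun i => (1 / 2 : ℝ) * X i ((0 : ℕ) : ℤ) u ^ 2)
        (fun i _ => by positivity) (Finset.mem_univ j)
      simpa using this
    simpa [hE₀] using hj.trans (h0le.trans hEn)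
  -- envelope scale `M₀ = √(2 max(D,1) E₀)`, perturbed by `δ > 0` to be positive
  set M₀ : ℝ := Real.sqrt (2 * max D 1 * E₀) with hM₀
  have hM₀0 : 0 ≤ M₀ := Real.sqrt_nonneg _
  have hD1 : D ≤ max D 1 := le_max_left _ _
  have h1D : (1 : ℝ) ≤ max D 1 := le_max_right _ _
  have hM₀sq : M₀ ^ 2 = 2 * max D 1 * E₀ := by
    rw [hM₀, Real.sq_sqrt (by positivity)]
  -- the primary envelope in amplitude form
  have hPamp : ∀ u ∈ Icc (0 : ℝ) s, ∀ i, lev i = 0 → ∀ k : ℕ,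
      |X i (k : ℤ) u| ≤ M₀ * (1 + ε₀) ^ (-(θ * (k : ℝ))) := by
    intro u hu i hi k
    have h := hprim ν hν X₀ s hs X hdat hlow ⟨Mw, hMw⟩ hcont hder hnn u hu i hi k
    have hw : 0 < (1 + ε₀) ^ (2 * θ * (k : ℝ)) := Real.rpow_pos_of_pos hb _
    have hc' : 0 < (1 + ε₀) ^ (-(θ * (k : ℝ))) := Real.rpow_pos_of_pos hb _
    have hinv : (1 + ε₀) ^ (2 * θ * (k : ℝ)) * ((1 + ε₀) ^ (-(θ * (k : ℝ)))) ^ 2 = 1 := by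
      rw [← Real.rpow_natCast, ← Real.rpow_mul hb.le, ← Real.rpow_add hb]
      have : 2 * θ * (k : ℝ) + -(θ * (k : ℝ)) * ((2 : ℕ) : ℝ) = 0 := by push_cast; ring
      rw [this, Real.rpow_zero]
    -- `X² ≤ 2 max(D,1) E₀ (1+ε₀)^{-2θk} = (M₀ c)²`
    have hx2 : X i (k : ℤ) u ^ 2 ≤ (M₀ * (1 + ε₀) ^ (-(θ * (k : ℝ)))) ^ 2 := by
      rw [mul_pow, hM₀sq]
      have hDE : D * E₀ ≤ max D 1 * E₀ := mul_le_mul_of_nonneg_right hD1 hE₀0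
      -- multiply the barrier by `c² = (1+ε₀)^{-2θk}`
      have hmul := mul_le_mul_of_nonneg_right (h.trans hDE) (sq_nonneg ((1 + ε₀) ^ (-(θ * (k : ℝ)))))
      have hlhs : (1 + ε₀) ^ (2 * θ * (k : ℝ)) * ((1 / 2 : ℝ) * X i (k : ℤ) u ^ 2) *
          ((1 + ε₀) ^ (-(θ * (k : ℝ)))) ^ 2 = (1 / 2 : ℝ) * X i (k : ℤ) u ^ 2 := by
        have := hinv
        calc (1 + ε₀) ^ (2 * θ * (k : ℝ)) * ((1 / 2 : ℝ) * X i (k : ℤ) u ^ 2) *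
              ((1 + ε₀) ^ (-(θ * (k : ℝ)))) ^ 2
            = ((1 + ε₀) ^ (2 * θ * (k : ℝ)) * ((1 + ε₀) ^ (-(θ * (k : ℝ)))) ^ 2) *
                ((1 / 2 : ℝ) * X i (k : ℤ) u ^ 2) := by ring
          _ = (1 / 2 : ℝ) * X i (k : ℤ) u ^ 2 := by rw [this, one_mul]
      rw [hlhs] at hmul
      nlinarith [hmul]
    have hnn' : 0 ≤ M₀ * (1 + ε₀) ^ (-(θ * (k : ℝ))) := by positivity
    exact abs_le_of_sq_le_sq' hx2 hnn' |>.2 |> fun hle => abs_le.2 ⟨(abs_le_of_sq_le_sq' hx2 hnn').1, hle⟩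
  have h0amp : ∀ u ∈ Icc (0 : ℝ) s, ∀ j, |X j 0 u| ≤ M₀ := by
    intro u hu j
    have h := hshell0 u hu j
    have hx2 : X j 0 u ^ 2 ≤ M₀ ^ 2 := by
      rw [hM₀sq]; nlinarith [hE₀0, h1D, mul_nonneg (sub_nonneg.2 h1D) hE₀0]
    exact abs_le.2 ⟨(abs_le_of_sq_le_sq' hx2 hM₀0).1, (abs_le_of_sq_le_sq' hx2 hM₀0).2⟩
  -- zero datum on shells ≥ 1
  have hdat1 : ∀ (i : Fin 4) (k : ℤ), 1 ≤ k → X i k 0 = 0 := by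
    intro i k hk
    rw [hdat i k, if_neg (by omega)]
  -- every source is enveloped by `20 R (M₀ + δ)` for every `δ > 0`, hence by `20 R M₀`
  have hR20 : (1 : ℝ) ≤ 20 * R := by linarith
  have hsources : ∀ a ∈ S, ∀ k : ℕ,
      |X a (k : ℤ) t| ≤ (20 * R) ^ L * M₀ * (1 + ε₀) ^ (-(θ * (k : ℝ))) := by
    intro a ha k
    have hsrc := (hSmem a).1 ha
    have hc' : 0 < (1 + ε₀) ^ (-(θ * (k : ℝ))) := Real.rpow_pos_of_pos hb _
    have hRL : (1 : ℝ) ≤ (20 * R) ^ L := one_le_pow₀ hR20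
    apply le_of_forall_pos_le_add
    intro η hη
    set δ : ℝ := η / ((20 * R) ^ L * (1 + ε₀) ^ (-(θ * (k : ℝ)))) with hδ
    have hδpos : 0 < δ := by positivity
    have hMδ : 0 < M₀ + δ := by linarith
    have hres := kpProper_sources_envelope_graded (W := Mw) ⟨‹IsSymmetricCoeff α›, hc, ‹_›⟩ hO hDg hR hε hε1 hν.le
      (by linarith) hθ1 hMδ hder hdat1 hnn hWbd lev
      (fun u hu i hi m => (hPamp u hu i hi m).trans
        (mul_le_mul_of_nonneg_right (by linarith) (Real.rpow_pos_of_pos hb _).le))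
      (fun u hu j => (h0amp u hu j).trans (by linarith)) hstruct t ht a (Or.inr hsrc) k
    have hmono : (20 * R) ^ (lev a) * (M₀ + δ) * (1 + ε₀) ^ (-(θ * (k : ℝ))) ≤
        (20 * R) ^ L * (M₀ + δ) * (1 + ε₀) ^ (-(θ * (k : ℝ))) := by
      have h1 : (20 * R) ^ (lev a) ≤ (20 * R) ^ L := pow_le_pow_right₀ hR20 (hL a)
      have h2 : 0 ≤ (M₀ + δ) * (1 + ε₀) ^ (-(θ * (k : ℝ))) := by positivity
      nlinarith
    have : (20 * R) ^ L * (M₀ + δ) * (1 + ε₀) ^ (-(θ * (k : ℝ))) =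
        (20 * R) ^ L * M₀ * (1 + ε₀) ^ (-(θ * (k : ℝ))) + η := by
      simp only [hδ]; field_simp
    linarith
  -- the geometric tail sum
  have htail := sources_tail_le (S := S) hε (by linarith) (by positivity) hsources n N hnN
  have hconst : 2 * ((20 * R) ^ L * M₀) ^ 2 / (1 - (1 + ε₀) ^ (-(2 * θ))) =
      4 * (20 * R) ^ (2 * L) * max D 1 / (1 - r) * E₀ := by
    rw [← hr_def, mul_pow, hM₀sq, ← pow_mul]; field_simp; ring
  rw [hconst] at htail
  simpa [hE₀] using htail

end Summit.NavierStokesRegularity.NavierStokesRegularity.Theorems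

end
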